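import Literature.Geometry.Kaehler.LocalDeRhamComplex
import HarnessLib

/-!
# The Poincaré lemma for the de Rham complex of a star-shaped chart set

The tree's Poincaré lemma `localClosedForms_chartSet_le_localExactForms` /
`localDeRhamComplex.isZero_homology_chartSet` is stated for chart-CONVEX sets, but its proof (the
cone operator of `PoincareLemmaStarConvex.lean`, Lee (2013), Thm. 17.14) only uses that the open
set `C` of the chart is STAR-SHAPED with respect to one of its points.  This file records the
star-shaped versions (`localClosedForms_chartSet_le_localExactForms_of_starConvex`,
`localDeRhamComplex.isZero_homology_chartSet_of_starConvex`) and, for the model vector space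
itself (`M = E`, where chart sets are the sets themselves), the Poincaré lemma for a star-shaped
open subset `W ⊆ E`: `Hᵠ(Ω•(W)) = 0` for `q ≥ 1` (`localDeRhamComplex.isZero_homology_of_starConvex`).

Everything is proved; no named facts.

## References

* [LeeSmoothManifolds2013] J. M. Lee, *Introduction to Smooth Manifolds*, 2nd ed., Thm. 17.14.
* [BottTu1982Forms] R. Bott, L. W. Tu, *Differential Forms in Algebraic Topology* (1982), §I.4 Cor. 4.1.1.
-/

noncomputable section

open scoped Manifold ContDiff Topology
open CategoryTheory Limits Set Filter
open Literature.AlgebraicTopology.SingularHomology (isZero_homology_iff exists_d_prev_eq_iff d_next_eq_zero_iff)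

universe u v

namespace Literature.Geometry.Kaehler

variable {E : Type u} [NormedAddCommGroup E] [NormedSpace ℝ E]
  {H : Type*} [TopologicalSpace H] {I : ModelWithCorners ℝ E H}
  {M : Type u} [TopologicalSpace M] [ChartedSpace H M] [IsManifold I ∞ M] [I.Boundaryless]
  {F : Type v} [NormedAddCommGroup F] [NormedSpace ℝ F] [FiniteDimensional ℝ E] [CompleteSpace F] {k : ℕ}

/-- **Poincaré lemma on star-shaped chart sets, positive degree**: on the chart set of an open
`C ⊆ e.target` star-shaped with respect to `c₀`, every closed `(k+1)`-form is exact (it is `d_W` of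
the transported cone transform about `c₀`; Lee (2013), Thm. 17.14). The proof is that of the tree's
`localClosedForms_chartSet_le_localExactForms`, which only used star-shapedness.
[cite: LeeSmoothManifolds2013, Thm. 17.14] -/
theorem localClosedForms_chartSet_le_localExactForms_of_starConvex (p : M) {C : Set E} (hC : IsOpen C)
    {c₀ : E} (hst : StarConvex ℝ c₀ C) (hCT : C ⊆ (extChartAt I p).target) :
    localClosedForms I F (k + 1) (chartSet I p C) ≤
      localExactForms I F (isOpen_chartSet I p hC) (k + 1) := by
  intro α hα
  set η : E → E [⋀^Fin (k + 1)]→L[ℝ] F := α.inChart p with hη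
  have hηs : ContDiffOn ℝ ∞ η C := contDiffOn_inChart_of_mem_smoothFormsOn hCT hα.1
  have hηd : ∀ y ∈ C, extDeriv η y = 0 := fun y hy ↦
    extDeriv_inChart_eq_zero_of_mem_localClosedForms hCT hα hy
  set γ : E → E [⋀^Fin k]→L[ℝ] F := coneOperator c₀ η with hγ
  have hγs : ContDiffOn ℝ ∞ γ C := contDiffOn_coneOperator hC hst hηs
  have hγd : ∀ y ∈ C, extDeriv γ y = η y := fun y hy ↦
    extDeriv_coneOperator_of_extDeriv_eq_zero hC hst hηs hηd hy
  set β : smoothFormsOn I F (chartSet I p C) k :=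
    ⟨MForm.ofChartOn p (chartSet I p C) γ, ofChartOn_mem_smoothFormsOn hC hCT hγs⟩ with hβ
  refine (mem_localExactForms_succ_iff (isOpen_chartSet I p hC)).2 ⟨β, funext fun x ↦ ?_⟩
  by_cases hx : x ∈ chartSet I p C
  · rw [localD_apply_of_mem _ _ hx]
    have hx' : (extChartAt I p).symm (extChartAt I p x) = x := (extChartAt I p).left_inv hx.1
    have key : (mextDeriv (β : MForm I M F k)).inChart p (extChartAt I p x) =
        α.inChart p (extChartAt I p x) := by
      rw [hβ]
      change (mextDeriv (MForm.ofChartOn p (chartSet I p C) γ : MForm I M F k)).inChart p _ = _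
      rw [inChart_mextDeriv_ofChartOn hC hCT hγs hx.2, hγd _ hx.2]
    have := MForm.apply_symm_eq_of_inChart_eq ((extChartAt I p).map_source hx.1) key
    rwa [hx'] at this
  · rw [coe_localD, MForm.restr_apply_of_notMem _ hx, hα.1.2 x hx]

/-- **Poincaré lemma for the de Rham complex of a star-shaped chart set**: `Hᵠ(Ω•(chartSet I p C)) = 0`
for `q ≥ 1` when `C ⊆ e.target` is open and star-shaped. [cite: LeeSmoothManifolds2013, Thm. 17.14] -/
theorem localDeRhamComplex.isZero_homology_chartSet_of_starConvex (p : M) {C : Set E} (hC : IsOpen C)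
    {c₀ : E} (hst : StarConvex ℝ c₀ C) (hCT : C ⊆ (extChartAt I p).target) (q : ℕ) :
    IsZero ((localDeRhamComplex I F (isOpen_chartSet I p hC)).homology (q + 1)) := by
  rw [isZero_homology_iff]
  intro z hz
  rw [d_next_eq_zero_iff (cnext (q + 1)), localDeRhamComplex_d_eq_zero_iff] at hz
  rw [exists_d_prev_eq_iff (cprev q), localDeRhamComplex_exists_d_eq_iff]
  exact localClosedForms_chartSet_le_localExactForms_of_starConvex p hC hst hCT hz

omit [I.Boundaryless] [FiniteDimensional ℝ E] [CompleteSpace F] in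
/-- Vanishing of the cohomology of the de Rham complex only depends on the open set (transport along
an equality of sets). [folklore] -/
theorem localDeRhamComplex.isZero_homology_congr_set {S T : Set M} (e : S = T)
    (hS : IsOpen S) (hT : IsOpen T) (q : ℕ)
    (h : IsZero ((localDeRhamComplex I F hS).homology q)) :
    IsZero ((localDeRhamComplex I F hT).homology q) := by
  subst e
  exact h

omit [IsManifold I ∞ M] [I.Boundaryless] [FiniteDimensional ℝ E] [CompleteSpace F] [ChartedSpace H M] [TopologicalSpace M] in
/-- In the model vector space the chart set of `W` at any point is `W` itself. [folklore] -/
theorem chartSet_model_space (p : E) (W : Set E) : chartSet 𝓘(ℝ, E) p W = W := by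
  ext x
  rw [mem_chartSet_iff, extChartAt_model_space_eq_id]
  simp

/-- **Poincaré lemma for a star-shaped open subset of the model vector space**: `Hᵠ(Ω•(W)) = 0` for
`q ≥ 1` (de Rham complex of forms on `W ⊆ E` computed in `E`; Lee (2013), Thm. 17.14).
[cite: LeeSmoothManifolds2013, Thm. 17.14] -/
theorem localDeRhamComplex.isZero_homology_of_starConvex {W : Set E} (hW : IsOpen W) {c₀ : E}
    (hst : StarConvex ℝ c₀ W) (q : ℕ) :
    IsZero ((localDeRhamComplex 𝓘(ℝ, E) F hW).homology (q + 1)) := by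
  have hWT : W ⊆ (extChartAt 𝓘(ℝ, E) c₀).target := by
    rw [extChartAt_model_space_eq_id]
    exact subset_univ _
  exact localDeRhamComplex.isZero_homology_congr_set (I := 𝓘(ℝ, E)) (chartSet_model_space c₀ W) _ hW (q + 1)
    (localDeRhamComplex.isZero_homology_chartSet_of_starConvex (I := 𝓘(ℝ, E)) (F := F) c₀ hW hst hWT q)

end Literature.Geometry.Kaehler
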